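import Summits.HubbardSuperconductivity.HubbardSuperconductivity.Theorems.BalabanIRBirComplexStableXYRRotorWitnessCrux
import HarnessLib

/-!
# RP-free long-range order of the `(2+1)`-dimensional XY rotor on `(ℤ/L)² × ℤ/M`:
# VI. The full real Fourier-negative cone (multi-spin ferromagnetic tables)

Sixth file of the BC5 witness for `BirComplexStableXYR` (stmt-HubbardSuperconductivity-14845,
route `BalabanIR`).  File V proved the crux's conclusion for tables whose symbol is a PAIR
ferromagnet `∑ J_{ww'}(1 − cos(φ_w − φ_{w'}))`.  Ginibre's inequality is indifferent to the arity of
the interaction: here the same conclusion — `Z ≠ 0 ∧ 1/2 ≤ Re(∫ O e^{−A}/Z)` with the crux's own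
`sh, F, A, cube, Z, O`, uniform `K₀, L₀`, no parity, no reflection positivity — is proved for every
table whose symbol lies in the full REAL FOURIER-NEGATIVE CONE

  `F(φ) = ∑_{m ∈ S} a_m (1 − cos(m·φ))`,  `a ≥ 0`,  `S ⊂ (W_r → ℤ)` finite,

containing the three nearest-neighbour differences `e_{(0,0,0)} − e_{(1,0,0)}`, `e_{(0,0,0)} − e_{(0,1,0)}`,
`e_{(0,0,0)} − e_{(0,0,1)}` with weights `≥ 1` ("real Fourier-negative ferromagnetic tables", the
`ginibre-ferromagnetic-cone` face named in the crux's statement): `birComplexStableXYR_fourierNegativeCone`.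
The Ginibre characters are the window monomials `θ ↦ ∏_w θ_{sh_s w}^{m_w}` (`exists_monomialChar`).

## References
* J. Ginibre, Comm. Math. Phys. 16 (1970) 310–328 (general ferromagnetic `cos(m·φ)` interactions).
  [Ginibre1970]
* C. Garban, T. Spencer, arXiv:2109.01617, Thm. 1.3 / Remark 1. [GarbanSpencer2022]
-/

noncomputable section

set_option linter.dupNamespace false -- summit = problem name (single-conjunct summit), D-0017

namespace Summit.HubbardSuperconductivity.HubbardSuperconductivity.Theorems

open MeasureTheory Finset Set
open scoped BigOperators ComplexConjugate
open Literature.Probability.LatticeModels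

/-! ### Window monomial characters -/

/-- **Monomial characters of the torus `U(1)^V`.** For sites `p a : W → V` and exponents
`m a : W → ℤ` there are continuous unitary characters `χ_a(θ) = ∏_w θ_{p a w}^{m a w}`. [folklore] -/
theorem exists_monomialChar {V W ι : Type*} [Fintype W] (p : ι → W → V) (m : ι → W → ℤ) :
    ∃ χ : ι → (V → Circle) →ₜ* Circle, ∀ a θ, χ a θ = ∏ w, θ (p a w) ^ m a w := by
  refine ⟨fun a =>
    { toFun := fun θ => ∏ w, θ (p a w) ^ m a w
      map_one' := by simp
      map_mul' := fun θ θ' => by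
        simp only [Pi.mul_apply, mul_zpow, Finset.prod_mul_distrib]
      continuous_toFun := continuous_finsetProd _ fun w _ => (continuous_apply (p a w)).zpow (m a w) },
    fun a θ => rfl⟩

/-- The real part of a window monomial at `e^{iθ}`: `Re ∏_w (e^{iθ_w})^{m_w} = cos(∑_w m_w θ_w)`.
[folklore] -/
theorem re_prod_exp_zpow {W : Type*} [Fintype W] (t : W → ℝ) (m : W → ℤ) :
    (((∏ w, Circle.exp (t w) ^ m w : Circle) : ℂ)).re = Real.cos (∑ w, (m w : ℝ) * t w) := by
  have h : (((∏ w, Circle.exp (t w) ^ m w : Circle) : ℂ)) = Complex.exp ((∑ w, (m w : ℝ) * t w : ℝ) * Complex.I) := by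
    rw [← Circle.coeHom_apply, map_prod]
    simp only [Circle.coeHom_apply, Circle.coe_zpow, Circle.coe_exp, ← Complex.exp_int_mul, ← Complex.exp_sum]
    congr 1
    push_cast
    rw [Finset.sum_mul]
    refine Finset.sum_congr rfl fun w _ => by ring
  rw [h, Complex.exp_ofReal_mul_I_re]

/-- A monomial with exponent `e_u − e_v` is the relative angle `θ_u θ_v⁻¹`; its real part is
`cosDiff u v`. [folklore] -/
theorem re_prod_zpow_single_sub_single {V W : Type*} [Fintype W] [DecidableEq W] (p : W → V) (u v : W)
    (θ : V → Circle) :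
    ((∏ w, θ (p w) ^ ((Pi.single u (1 : ℤ) - Pi.single v (1 : ℤ) : W → ℤ) w) : Circle) : ℂ).re =
      cosDiff (p u) (p v) θ := by
  have hsingle : ∀ x : W, ∏ w, θ (p w) ^ ((Pi.single x (1 : ℤ) : W → ℤ) w) = θ (p x) := by
    intro x
    rw [Finset.prod_eq_single x (fun w _ hw => by rw [Pi.single_eq_of_ne hw, zpow_zero])
      (fun h => (h (Finset.mem_univ x)).elim), Pi.single_eq_same, zpow_one]
  have hprod : ∏ w, θ (p w) ^ ((Pi.single u (1 : ℤ) - Pi.single v (1 : ℤ) : W → ℤ) w) = θ (p u) * (θ (p v))⁻¹ := by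
    simp only [Pi.sub_apply, zpow_sub, Finset.prod_mul_distrib, Finset.prod_inv_distrib, hsingle]
  rw [hprod, cosDiff_comm, cosDiff, Circle.coe_mul, Circle.coe_inv_eq_conj, mul_comm]

/-! ### The rung on the real Fourier-negative cone -/

/-- **BC5 WITNESS on the real Fourier-negative cone (multi-spin ferromagnets), in the crux's own
words.**  There are `K₀, L₀` such that for every `r ≥ 2`, every finite set `S` of window
multi-indices `m : W_r → ℤ` with non-negative weights `a`, containing the three nearest-neighbour
differences `e_{(0,0,0)} − e_{(1,0,0)}`, `e_{(0,0,0)} − e_{(0,1,0)}`, `e_{(0,0,0)} − e_{(0,0,1)}` with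
weights `≥ 1`, every `K ≥ K₀`, every Fourier table `c` whose symbol is
`∑_n c_n e^{i n·φ} = ∑_{m ∈ S} a_m (1 − cos(m·φ))`, and all `L₀ ≤ L ≤ M` (no evenness): with
`sh, F, A, cube, Z, O` LITERALLY as in `…Theses.BalabanIR.BirComplexStableXYR`,
`Z ≠ 0 ∧ 1/2 ≤ Re(∫ O e^{−A}/Z)`.  Proof: Ginibre monotonicity for the window monomial characters
`∏_w θ_{sh_s w}^{m_w}` (couplings `K a_m ≥ K·1_{nn}`, whose Ginibre weight is the XY weight of the
space-time bond system), the all-pairs bound `xyRotor_slice_twoPoint_ge_half` (Garban–Spencer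
through imaginary time), and the angle-cube dictionary. [cite: Ginibre1970, main theorem with the plane-rotator example cos(m·φ)] -/
theorem birComplexStableXYR_fourierNegativeCone :
    ∃ K₀ : ℝ, ∃ L₀ : ℕ, ∀ (r : ℕ) (hr : 1 < r) (S : Finset ((Fin r × Fin r × Fin r) → ℤ)) (a : ((Fin r × Fin r × Fin r) → ℤ) → ℝ), (∀ m, 0 ≤ a m) → (Pi.single ((⟨0, Nat.zero_lt_of_lt hr⟩, ⟨0, Nat.zero_lt_of_lt hr⟩, ⟨0, Nat.zero_lt_of_lt hr⟩) : Fin r × Fin r × Fin r) (1 : ℤ) - Pi.single ((⟨1, hr⟩, ⟨0, Nat.zero_lt_of_lt hr⟩, ⟨0, Nat.zero_lt_of_lt hr⟩) : Fin r × Fin r × Fin r) (1 : ℤ)) ∈ S → (Pi.single ((⟨0, Nat.zero_lt_of_lt hr⟩, ⟨0, Nat.zero_lt_of_lt hr⟩, ⟨0, Nat.zero_lt_of_lt hr⟩) : Fin r × Fin r × Fin r) (1 : ℤ) - Pi.single ((⟨0, Nat.zero_lt_of_lt hr⟩, ⟨1, hr⟩, ⟨0, Nat.zero_lt_of_lt hr⟩)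 : Fin r × Fin r × Fin r) (1 : ℤ)) ∈ S → (Pi.single ((⟨0, Nat.zero_lt_of_lt hr⟩, ⟨0, Nat.zero_lt_of_lt hr⟩, ⟨0, Nat.zero_lt_of_lt hr⟩) : Fin r × Fin r × Fin r) (1 : ℤ) - Pi.single ((⟨0, Nat.zero_lt_of_lt hr⟩, ⟨0, Nat.zero_lt_of_lt hr⟩, ⟨1, hr⟩) : Fin r × Fin r × Fin r) (1 : ℤ)) ∈ S → 1 ≤ a (Pi.single ((⟨0, Nat.zero_lt_of_lt hr⟩, ⟨0, Nat.zero_lt_of_lt hr⟩, ⟨0, Nat.zero_lt_of_lt hr⟩) : Fin r × Fin r × Fin r) (1 : ℤ) - Pi.single ((⟨1, hr⟩, ⟨0, Nat.zero_lt_of_lt hr⟩, ⟨0, Nat.zero_lt_of_lt hr⟩) : Fin r × Fin r × Fin r) (1 : ℤ)) → 1 ≤ a (Pi.single ((⟨0, Nat.zero_lt_of_lt hr⟩, ⟨0, Nat.zero_lt_of_lt hr⟩, ⟨0, Nat.zero_lt_of_lt hr⟩) : Fin r × Fin r × Fin r) (1 : ℤ) - Pi.single ((⟨0, Nat.zero_lt_of_lt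 hr⟩, ⟨1, hr⟩, ⟨0, Nat.zero_lt_of_lt hr⟩) : Fin r × Fin r × Fin r) (1 : ℤ)) → 1 ≤ a (Pi.single ((⟨0, Nat.zero_lt_of_lt hr⟩, ⟨0, Nat.zero_lt_of_lt hr⟩, ⟨0, Nat.zero_lt_of_lt hr⟩) : Fin r × Fin r × Fin r) (1 : ℤ) - Pi.single ((⟨0, Nat.zero_lt_of_lt hr⟩, ⟨0, Nat.zero_lt_of_lt hr⟩, ⟨1, hr⟩) : Fin r × Fin r × Fin r) (1 : ℤ)) → ∀ K : ℝ, K₀ ≤ K → ∀ c : ((Fin r × Fin r × Fin r) → ℤ) →₀ ℂ, (∀ φ : (Fin r × Fin r × Fin r) → ℝ, c.sum (fun n a => a * Complex.exp (Complex.I * ((∑ w, (n w : ℝ) * φ w : ℝ) : ℂ))) = ((∑ m ∈ S, a m * (1 - Real.cos (∑ w, (m w : ℝ) * φ w)) : ℝ) : ℂ)) → ∀ (L M : ℕ) [NeZero L] [NeZero M], L₀ ≤ L → L ≤ M → let sh : (Literature.Probability.LatticeModels.TorusSite 2 L × ZMod M) → (Fin r × Fin r × Fin r) → (Literature.Probability.LatticeModels.TorusSite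 2 L × ZMod M) := fun s w => (s.1 + ![((w.1 : ℕ) : ZMod L), ((w.2.1 : ℕ) : ZMod L)], s.2 + ((w.2.2 : ℕ) : ZMod M)); let F : ((Fin r × Fin r × Fin r) → ℝ) → ℂ := fun (φ : (Fin r × Fin r × Fin r) → ℝ) => c.sum (fun n a => a * Complex.exp (Complex.I * ((∑ w, (n w : ℝ) * φ w : ℝ) : ℂ))); let A : ((Literature.Probability.LatticeModels.TorusSite 2 L × ZMod M) → ℝ) → ℂ := fun θ => (K : ℂ) * ∑ s : (Literature.Probability.LatticeModels.TorusSite 2 L × ZMod M), F (fun w => θ (sh s w)); let cube : Set ((Literature.Probability.LatticeModels.TorusSite 2 L × ZMod M) → ℝ) := Set.pi Set.univ (fun _ => Set.Icc (0:ℝ) (2 * Real.pi)); let Z : ℂ := MeasureTheory.integral (MeasureTheory.volume.restrict cube) (fun θ => Complex.exp (-(A θ))); let O : ((Literature.Probability.LatticeModels.TorusSite 2 L × ZMod M) → ℝ) → ℝ := fun θ => ‖∑ x : Literature.Probability.LatticeModels.TorusSite 2 L, Complex.exp (Complex.I * (θ (x, 0) : ℂ))‖ ^ 2 / (L : ℝ)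 ^ 4; Z ≠ 0 ∧ (1/2 : ℝ) ≤ ((MeasureTheory.integral (MeasureTheory.volume.restrict cube) (fun θ => (O θ : ℂ) * Complex.exp (-(A θ)))) / Z).re := by
  obtain ⟨K₂, hK₂, hall⟩ := xyRotor_slice_twoPoint_ge_half
  refine ⟨K₂, 40, ?_⟩
  intro r hr S a ha h1S h2S h3S ha1 ha2 ha3 K hK c hc L M _ _ hL hLM sh F A cube Z O
  simp only [F, A, cube, Z, O]
  have hK0 : 0 ≤ K := le_trans hK₂.le hK
  -- abbreviations
  set o : Fin r := ⟨0, Nat.zero_lt_of_lt hr⟩ with ho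
  set i : Fin r := ⟨1, hr⟩ with hi
  have hio : i ≠ o := by simp [hi, ho, Fin.ext_iff]
  set G := JCurrent.bondSystem 2 L M with hG
  -- the three nearest-neighbour multi-indices, as (distinct) elements of `S`
  have hne1 : ((i, o, o) : Fin r × Fin r × Fin r) ≠ (o, o, o) := by simp [hio]
  have hne2 : ((o, i, o) : Fin r × Fin r × Fin r) ≠ (o, o, o) := by simp [hio]
  have hne3 : ((o, o, i) : Fin r × Fin r × Fin r) ≠ (o, o, o) := by simp [hio]
  have hM12 : (⟨_, h1S⟩ : ↥S) ≠ ⟨_, h2S⟩ := by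
    intro h
    have h' := congrArg (fun m : ↥S => (m : (Fin r × Fin r × Fin r) → ℤ) (i, o, o)) h
    simp [hio] at h'
  have hM13 : (⟨_, h1S⟩ : ↥S) ≠ ⟨_, h3S⟩ := by
    intro h
    have h' := congrArg (fun m : ↥S => (m : (Fin r × Fin r × Fin r) → ℤ) (i, o, o)) h
    simp [hio] at h'
  have hM23 : (⟨_, h2S⟩ : ↥S) ≠ ⟨_, h3S⟩ := by
    intro h
    have h' := congrArg (fun m : ↥S => (m : (Fin r × Fin r × Fin r) → ℤ) (o, i, o)) h
    simp [hio] at h'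
  -- the Ginibre rendering: window monomial characters, couplings `K a_m`
  obtain ⟨χ, hχ⟩ := exists_monomialChar (V := JCurrent.SpaceTimeSite 2 L M)
    (fun b : JCurrent.SpaceTimeSite 2 L M × ↥S => sh b.1) (fun b => (b.2 : (Fin r × Fin r × Fin r) → ℤ))
  set Jhi : JCurrent.SpaceTimeSite 2 L M × ↥S → ℝ := fun b => K * a b.2 with hJhi
  set J0 : ↥S → ℝ := fun m =>
    (if m = ⟨_, h1S⟩ then 1 else 0) + (if m = ⟨_, h2S⟩ then 1 else 0) + (if m = ⟨_, h3S⟩ then 1 else 0) with hJ0def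
  set Jlo : JCurrent.SpaceTimeSite 2 L M × ↥S → ℝ := fun b => K * J0 b.2 with hJlo
  have hJ0nn : ∀ m, 0 ≤ J0 m := by
    intro m; simp only [hJ0def]
    refine add_nonneg (add_nonneg ?_ ?_) ?_ <;> split_ifs <;> norm_num
  have hJlo0 : ∀ b, 0 ≤ Jlo b := fun b => by simp only [hJlo]; exact mul_nonneg hK0 (hJ0nn b.2)
  have hJ0le : ∀ m : ↥S, J0 m ≤ a m := by
    intro m
    simp only [hJ0def]
    by_cases h1 : m = ⟨_, h1S⟩
    · rw [if_pos h1, if_neg (fun e => hM12 (h1.symm.trans e)), if_neg (fun e => hM13 (h1.symm.trans e)), h1]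
      simpa using ha1
    by_cases h2 : m = ⟨_, h2S⟩
    · rw [if_neg h1, if_pos h2, if_neg (fun e => hM23 (h2.symm.trans e)), h2]
      simpa using ha2
    by_cases h3 : m = ⟨_, h3S⟩
    · rw [if_neg h1, if_neg h2, if_pos h3, h3]
      simpa using ha3
    rw [if_neg h1, if_neg h2, if_neg h3]
    simpa using ha m
  have hJle : ∀ b, Jlo b ≤ Jhi b := fun b => by
    simp only [hJlo, hJhi]; exact mul_le_mul_of_nonneg_left (hJ0le b.2) hK0
  -- the three nearest-neighbour shifts
  have hsh0 : ∀ s : JCurrent.SpaceTimeSite 2 L M, sh s (o, o, o) = s := by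
    intro s; refine Prod.ext ?_ ?_
    · funext j; fin_cases j <;> simp [sh, ho]
    · simp [sh, ho]
  have hsh1 : ∀ s : JCurrent.SpaceTimeSite 2 L M, sh s (i, o, o) = (s.1 + ![1, 0], s.2) := by
    intro s; refine Prod.ext ?_ ?_
    · funext j; fin_cases j <;> simp [sh, ho, hi]
    · simp [sh, ho]
  have hsh2 : ∀ s : JCurrent.SpaceTimeSite 2 L M, sh s (o, i, o) = (s.1 + ![0, 1], s.2) := by
    intro s; refine Prod.ext ?_ ?_
    · funext j; fin_cases j <;> simp [sh, ho, hi]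
    · simp [sh, ho]
  have hsh3 : ∀ s : JCurrent.SpaceTimeSite 2 L M, sh s (o, o, i) = (s.1, s.2 + 1) := by
    intro s; refine Prod.ext ?_ ?_
    · funext j; fin_cases j <;> simp [sh, ho]
    · simp [sh, hi]
  -- the nearest-neighbour monomials are the relative angles
  have hre : ∀ (s : JCurrent.SpaceTimeSite 2 L M) (u v : Fin r × Fin r × Fin r) (hm : (Pi.single u (1 : ℤ) - Pi.single v 1) ∈ S)
      (φ : JCurrent.SpaceTimeSite 2 L M → Circle),
      reChar (χ (s, ⟨_, hm⟩)) φ = cosDiff (sh s u) (sh s v) φ := by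
    intro s u v hm φ
    rw [reChar, hχ]
    exact re_prod_zpow_single_sub_single (sh s) u v φ
  -- single-indicator sums over `S`
  have hSsum : ∀ (P : ↥S) (g : ↥S → ℝ), ∑ m, (if m = P then (1 : ℝ) else 0) * g m = g P := by
    intro P g
    simp only [ite_mul, one_mul, zero_mul, Finset.sum_ite_eq', Finset.mem_univ, if_true]
  -- the small Ginibre weight IS the XY weight
  have hlo_weight : ∀ φ : JCurrent.SpaceTimeSite 2 L M → Circle, ginibreWeight χ Jlo φ = G.weight K 1 φ := by
    intro φ
    rw [ginibreWeight, BondSystem.weight, hG, xyEnergy_eq_sum_sites, ginibreHamiltonian, Fintype.sum_prod_type,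
      Finset.mul_sum]
    congr 1
    refine Finset.sum_congr rfl fun s _ => ?_
    have hterm : ∀ m : ↥S, Jlo (s, m) * reChar (χ (s, m)) φ =
        K * ((if m = ⟨_, h1S⟩ then (1 : ℝ) else 0) * reChar (χ (s, m)) φ) +
          K * ((if m = ⟨_, h2S⟩ then (1 : ℝ) else 0) * reChar (χ (s, m)) φ) +
          K * ((if m = ⟨_, h3S⟩ then (1 : ℝ) else 0) * reChar (χ (s, m)) φ) := by
      intro m; simp only [hJlo, hJ0def]; ring
    rw [Finset.sum_congr rfl fun m _ => hterm m, Finset.sum_add_distrib, Finset.sum_add_distrib,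
      ← Finset.mul_sum, ← Finset.mul_sum, ← Finset.mul_sum,
      hSsum ⟨_, h1S⟩ (fun m => reChar (χ (s, m)) φ), hSsum ⟨_, h2S⟩ (fun m => reChar (χ (s, m)) φ),
      hSsum ⟨_, h3S⟩ (fun m => reChar (χ (s, m)) φ)]
    rw [hre s (o, o, o) (i, o, o) h1S φ, hre s (o, o, o) (o, i, o) h2S φ, hre s (o, o, o) (o, o, i) h3S φ,
      hsh0, hsh1, hsh2, hsh3]
    ring
  have hlo_expect : ∀ f : (JCurrent.SpaceTimeSite 2 L M → Circle) → ℝ,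
      ginibreExpect (torusHaar (JCurrent.SpaceTimeSite 2 L M)) χ Jlo f = G.expect K 1 f := by
    intro f
    rw [ginibreExpect, BondSystem.expect, BondSystem.partitionFn]
    simp only [hlo_weight]
  -- Ginibre: every two-point function of the table dominates the XY one, hence `≥ 1/2`
  have hpair : ∀ x y : TorusSite 2 L,
      (1 / 2 : ℝ) ≤ ginibreExpect (torusHaar (JCurrent.SpaceTimeSite 2 L M)) χ Jhi
        (cosDiff ((x, 0) : JCurrent.SpaceTimeSite 2 L M) ((y, 0))) := by
    intro x y
    have hmono := ginibreExpect_reChar_mono (torusHaar (JCurrent.SpaceTimeSite 2 L M)) surjective_mul_self_torus χ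
      (diffChar ((x, 0) : JCurrent.SpaceTimeSite 2 L M) ((y, 0))) hJlo0 hJle
    have e : (cosDiff ((x, 0) : JCurrent.SpaceTimeSite 2 L M) ((y, 0)) : (JCurrent.SpaceTimeSite 2 L M → Circle) → ℝ) =
        reChar (diffChar ((x, 0) : JCurrent.SpaceTimeSite 2 L M) ((y, 0))) :=
      funext fun θ => cosDiff_eq_reChar _ _ θ
    rw [e]
    refine le_trans ?_ hmono
    rw [← e, hlo_expect]
    exact hall K hK L M hL hLM x y
  -- the cube integrals are Ginibre integrals at `e^{iθ}`
  set c₀ : ℝ := K * ∑ _s : JCurrent.SpaceTimeSite 2 L M, ∑ m ∈ S, a m with hc₀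
  have hA : ∀ θ : JCurrent.SpaceTimeSite 2 L M → ℝ,
      Complex.exp (-((K : ℂ) * ∑ s : JCurrent.SpaceTimeSite 2 L M,
        c.sum (fun n a => a * Complex.exp (Complex.I * ((∑ w, (n w : ℝ) * θ (sh s w) : ℝ) : ℂ))))) =
        (((Real.exp (-c₀) * ginibreWeight χ Jhi (fun v => Circle.exp (θ v))) : ℝ) : ℂ) := by
    intro θ
    have h := fun s : JCurrent.SpaceTimeSite 2 L M => hc (fun w => θ (sh s w))
    simp only [h]
    have ec : ∀ (s : JCurrent.SpaceTimeSite 2 L M) (m : ↥S),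
        Jhi (s, m) * reChar (χ (s, m)) (fun v => Circle.exp (θ v)) =
          K * (a m * Real.cos (∑ w, ((m : (Fin r × Fin r × Fin r) → ℤ) w : ℝ) * θ (sh s w))) := by
      intro s m
      rw [hJhi, reChar, hχ, re_prod_exp_zpow]; ring
    have eS : ∀ s : JCurrent.SpaceTimeSite 2 L M,
        ∑ m : ↥S, a m * Real.cos (∑ w, ((m : (Fin r × Fin r × Fin r) → ℤ) w : ℝ) * θ (sh s w)) =
          ∑ m ∈ S, a m * Real.cos (∑ w, (m w : ℝ) * θ (sh s w)) := fun s =>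
      Finset.sum_coe_sort S (fun m : (Fin r × Fin r × Fin r) → ℤ => a m * Real.cos (∑ w, (m w : ℝ) * θ (sh s w)))
    have hH : ginibreHamiltonian χ Jhi (fun v => Circle.exp (θ v)) =
        K * ∑ s : JCurrent.SpaceTimeSite 2 L M, ∑ m ∈ S, a m * Real.cos (∑ w, (m w : ℝ) * θ (sh s w)) := by
      rw [ginibreHamiltonian, Fintype.sum_prod_type]
      simp only [ec, ← Finset.mul_sum, eS]
    have hF : ∀ s : JCurrent.SpaceTimeSite 2 L M,
        ∑ m ∈ S, a m * (1 - Real.cos (∑ w, (m w : ℝ) * θ (sh s w))) =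
          ∑ m ∈ S, a m - ∑ m ∈ S, a m * Real.cos (∑ w, (m w : ℝ) * θ (sh s w)) := by
      intro s; rw [← Finset.sum_sub_distrib]; exact Finset.sum_congr rfl fun m _ => by ring
    rw [ginibreWeight, hH, ← Real.exp_add, Complex.ofReal_exp, ← Complex.ofReal_sum, ← Complex.ofReal_mul,
      ← Complex.ofReal_neg]
    congr 1
    simp only [hF, Finset.sum_sub_distrib, hc₀]
    ring
  simp only [hA]
  set Oc : (JCurrent.SpaceTimeSite 2 L M → Circle) → ℝ := fun φ =>
    (∑ x : TorusSite 2 L, ∑ y : TorusSite 2 L, cosDiff ((x, 0) : JCurrent.SpaceTimeSite 2 L M) ((y, 0)) φ) / (L : ℝ) ^ 4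
    with hOc
  have hOcc : Continuous Oc := by
    rw [hOc]
    exact (continuous_finsetSum _ fun x _ => continuous_finsetSum _ fun y _ =>
      continuous_cosDiff _ _).div_const _
  have hwc : Continuous (ginibreWeight χ Jhi) := continuous_ginibreWeight χ Jhi
  have h1 := setIntegral_angleCube_comp_exp (V := JCurrent.SpaceTimeSite 2 L M) (fun φ => Oc φ * ginibreWeight χ Jhi φ)
    (hOcc.mul hwc).aestronglyMeasurable
  have h2 := setIntegral_angleCube_comp_exp (V := JCurrent.SpaceTimeSite 2 L M) (ginibreWeight χ Jhi)
    hwc.aestronglyMeasurable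
  simp only [smul_eq_mul] at h1 h2
  have key1 : (fun θ : JCurrent.SpaceTimeSite 2 L M → ℝ =>
      ((‖∑ x : TorusSite 2 L, Complex.exp (Complex.I * (θ (x, 0) : ℂ))‖ ^ 2 / (L : ℝ) ^ 4 : ℝ) : ℂ) *
        (((Real.exp (-c₀) * ginibreWeight χ Jhi (fun v => Circle.exp (θ v))) : ℝ) : ℂ)) =
      fun θ => (((Real.exp (-c₀) * (Oc (fun v => Circle.exp (θ v)) * ginibreWeight χ Jhi (fun v => Circle.exp (θ v)))) : ℝ) : ℂ) := by
    funext θ; rw [hOc, sliceOrder_eq_sum_cosDiff L M θ]; push_cast; ring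
  have key2 : (fun θ : JCurrent.SpaceTimeSite 2 L M → ℝ =>
      (((Real.exp (-c₀) * ginibreWeight χ Jhi (fun v => Circle.exp (θ v))) : ℝ) : ℂ)) =
      fun θ => (((Real.exp (-c₀) * ginibreWeight χ Jhi (fun v => Circle.exp (θ v))) : ℝ) : ℂ) := rfl
  have hZpos : 0 < ∫ u, ginibreWeight χ Jhi u ∂torusHaar (JCurrent.SpaceTimeSite 2 L M) :=
    integral_exp_pos (integrable_of_continuous_compactSpace _ hwc)
  rw [key1, integral_complex_ofReal, integral_complex_ofReal, integral_const_mul, integral_const_mul, h1, h2]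
  refine ⟨Complex.ofReal_ne_zero.2 (by positivity), ?_⟩
  rw [← Complex.ofReal_div, Complex.ofReal_re,
    mul_div_mul_left _ _ (ne_of_gt (Real.exp_pos _)), mul_div_mul_left _ _ (by positivity)]
  -- now a Ginibre expectation of `Oc`
  have hexp : (∫ u, Oc u * ginibreWeight χ Jhi u ∂torusHaar (JCurrent.SpaceTimeSite 2 L M)) /
      (∫ u, ginibreWeight χ Jhi u ∂torusHaar (JCurrent.SpaceTimeSite 2 L M)) =
      ginibreExpect (torusHaar (JCurrent.SpaceTimeSite 2 L M)) χ Jhi Oc := rfl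
  rw [hexp]
  have hlin : ginibreExpect (torusHaar (JCurrent.SpaceTimeSite 2 L M)) χ Jhi Oc = ((L : ℝ) ^ 4)⁻¹ *
      ∑ x : TorusSite 2 L, ∑ y : TorusSite 2 L, ginibreExpect (torusHaar (JCurrent.SpaceTimeSite 2 L M)) χ Jhi
        (cosDiff ((x, 0) : JCurrent.SpaceTimeSite 2 L M) ((y, 0))) := by
    have e : Oc = fun φ => ((L : ℝ) ^ 4)⁻¹ *
        ∑ x : TorusSite 2 L, ∑ y : TorusSite 2 L, cosDiff ((x, 0) : JCurrent.SpaceTimeSite 2 L M) ((y, 0)) φ := by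
      funext φ; simp only [hOc]; rw [div_eq_inv_mul]
    rw [e]
    exact ginibreExpect_const_mul_sum_sum (torusHaar (JCurrent.SpaceTimeSite 2 L M)) χ Jhi _
      (fun x y => cosDiff ((x, 0) : JCurrent.SpaceTimeSite 2 L M) ((y, 0))) (fun x y => continuous_cosDiff _ _)
  rw [hlin]
  have hcard : (Fintype.card (TorusSite 2 L) : ℝ) = (L : ℝ) ^ 2 := by
    rw [Fintype.card_fun, ZMod.card, Fintype.card_fin]; push_cast; ring
  have hL0 : (0 : ℝ) < L := by exact_mod_cast Nat.pos_of_ne_zero (NeZero.ne L)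
  have hsum : (1 / 2 : ℝ) * (L : ℝ) ^ 4 ≤ ∑ x : TorusSite 2 L, ∑ y : TorusSite 2 L,
      ginibreExpect (torusHaar (JCurrent.SpaceTimeSite 2 L M)) χ Jhi
        (cosDiff ((x, 0) : JCurrent.SpaceTimeSite 2 L M) ((y, 0))) := by
    calc (1 / 2 : ℝ) * (L : ℝ) ^ 4 = ∑ _x : TorusSite 2 L, ∑ _y : TorusSite 2 L, (1 / 2 : ℝ) := by
          rw [Finset.sum_const, Finset.sum_const, Finset.card_univ, nsmul_eq_mul, nsmul_eq_mul, hcard]; ring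
      _ ≤ _ := Finset.sum_le_sum fun x _ => Finset.sum_le_sum fun y _ => hpair x y
  rw [inv_mul_eq_div, le_div_iff₀ (by positivity)]
  exact hsum

end Summit.HubbardSuperconductivity.HubbardSuperconductivity.Theorems

end
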